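import Literature.AlgebraicGeometry.Frobenioids.LogPrimesLinearIndependent
import HarnessLib

/-!
# Frobenioids I, Lemma 6.5 (ii): the transcendence statement about logarithms of six primes (typed)

Mochizuki, *The geometry of Frobenioids I: the general theory*, Kyushu J. Math. **62** (2008)
293–400, Lemma 6.5 (ii), kurims text pp. 116–117 [cite: MochizukiFrdI2008, Lem. 6.5 (ii) p.116]: for
distinct primes `p₁, …, p₆` there are no `λ₁, λ₂ ∈ ℚ_{>0}` with
`log p₁ / log p₂ = λ₁ · log p₃ / log p₄ = λ₂ · log p₅ / log p₆` — proved in [FrdI] from Lang's theorem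
([Lang1]; [Baker] p. 119: the six exponentials theorem). Typed here as a named statement (split out of
`ArithmeticFrobenioids.lean`, Mathlib-only apart from the companion Lemma 6.5 (i) file, so that the proof
seat abc-iut-L6-t10's discharge via the tree's six exponentials theorem lands independently).
Lemma 6.5 (i) is PROVED in `LogPrimesLinearIndependent.lean`. No statement of the paper is strengthened.
-/

noncomputable section

namespace Literature.AlgebraicGeometry.Frobenioids

/-- **Lemma 6.5 (ii)** (typed): for distinct primes `p₁, …, p₆` there are no `λ₁, λ₂ ∈ ℚ_{>0}` with
`log p₁ / log p₂ = λ₁ · log p₃ / log p₄ = λ₂ · log p₅ / log p₆` — proved in [FrdI] from Lang's theorem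
([Lang1]; [Baker] p. 119, the six exponentials theorem) (FrdI pp. 116–117).
[cite: MochizukiFrdI2008, Lem. 6.5 (ii) p.116] -/
def Lemma65ii : Prop :=
  ∀ p : Fin 6 → Nat.Primes, Function.Injective p →
    ¬ ∃ l₁ l₂ : ℚ, 0 < l₁ ∧ 0 < l₂ ∧
      Real.log (p 0 : ℕ) / Real.log (p 1 : ℕ) = l₁ * (Real.log (p 2 : ℕ) / Real.log (p 3 : ℕ)) ∧
      l₁ * (Real.log (p 2 : ℕ) / Real.log (p 3 : ℕ)) = l₂ * (Real.log (p 4 : ℕ) / Real.log (p 5 : ℕ))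

end Literature.AlgebraicGeometry.Frobenioids

end
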